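import Literature.AlgebraicGeometry.ModuliOfAbelianVarieties.SiegelFamilyShimuraLocusEveryJ
import HarnessLib

/-!
# Shimura's Proposition 11, first assertion, as an equality of sets: `𝔥_g ∩ 𝔜_j` is exactly the image
# of the sweep `(x, y) ↦ (x + jxj) + i(y − jyj)`, `x`, `y` real symmetric, `y ≻ 0`; `𝔜_j ≠ ∅`, and a
# non-empty locus exists iff `g` is even (Shimura 1972, §3 Prop. 10–11)

Topic `Literature/AlgebraicGeometry/ModuliOfAbelianVarieties` (the Siegel-family files, namespace
`Literature.AlgebraicGeometry.ModuliOfAbelianVarieties.SiegelModuli`).  Lane `lit-hodgefound`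
(Track 2 foundations library), prover seat p15 generation 49, row g49-#6: packaging of g48-#6 §1 (the
sweep lands in `𝔥_g ∩ 𝔜_j`: `sweep_mem_siegelUpperHalfSpace`, `sweep_rel`) and g49-#1 §4 (every point of
`𝔥_g ∩ 𝔜_j` is swept: `exists_sweep_eq_of_locus`; `g` even ⟺ some integral `j` with `j² = −1`,
`ᵗj = −j` exists: `even_iff_exists_locusJ`) into the statement of Prop. 11's first assertion for EVERY
such `j`: an iff, an equality of sets, non-emptiness, and the parity statement.  THEOREMS ONLY: no
definition, no instance, no notation, no named fact (net Literature debt `0`), no `sorry`.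

## Source, VERBATIM

G. Shimura, *On the field of rationality for an abelian variety*, Nagoya Math. J. **45** (1972) 167–178,
held `paper:doi-10-1017-s0027763000014720`, §3 pp. 174–176: «Now we assume that `n` is even, and put
`n = 2m`. … **PROPOSITION 10.** … Let `j = (0 −1_m; 1_m 0)`, and let `𝔜` be the set of all `z ∈ 𝔖_n`
such that `jz = −z^ρ j`. …»  «**PROPOSITION 11.** The set `𝔜` of Prop. 10 is non-empty. … Proof. It can
easily be verified that every point `z` of `𝔜` can be written in the form `z = (a b; b′ −a^ρ)` with
complex matrices `a` and `b` of size `m` such that `ᵗa = a`, `ᵗb^ρ = b`.  Conversely, such a `z`, whose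
imaginary part is positive definite, belongs to `𝔜`.  If we put `a = x + iy` and `b = r + is` with real
matrices `x, y, r, s`, then the conditions become as follows: `ᵗx = x, ᵗy = y, ᵗr = r, ᵗs = −s`;
`(y s; −s y)` is positive definite.  Therefore `𝔜` is non-empty.»

## The tree's rendering (`𝔜_j = {Z : jZ = −Z̄j}` for an integral `j` with `j² = −1`, `ᵗj = −j`)

* `sweep_mem_locus` — for real symmetric `x`, `y`, `y ≻ 0`: `Z(x, y) ∈ 𝔥_g` and `jZ(x, y) = −Z̄(x, y)j`
  (g48-#6, with real inputs).
* **`mem_locus_iff_exists_sweep`** — `Z ∈ 𝔥_g ∧ jZ = −Z̄j` ⟺ `Z = Z(x, y)` for some real symmetric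
  `x`, `y` with `y ≻ 0` («every point … can be written in the form …  Conversely …»);
  **`locus_eq_image_sweep`** — the same as `𝔥_g ∩ 𝔜_j = Z(𝒫)`, `𝒫 = {(x, y) : ᵗx = x, ᵗy = y, y ≻ 0}`.
* **`locus_nonempty`** — «Therefore `𝔜` is non-empty»: `Z(0, ½·1) = i·1 ∈ 𝔥_g ∩ 𝔜_j`, for every such
  `j`; and `exists_locus_nonempty_iff_even` — an integral `j` with `j² = −1`, `ᵗj = −j` and non-empty
  `𝔥_g ∩ 𝔜_j` exists iff `g` is even («we assume that `n` is even»).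
-/

noncomputable section

open scoped Matrix ComplexConjugate
open Matrix Complex Function Set

namespace Literature.AlgebraicGeometry.ModuliOfAbelianVarieties

namespace SiegelModuli

open Literature.NumberTheory.Automorphic (siegelUpperHalfSpace)

variable {g : ℕ} (j : Matrix (Fin g) (Fin g) ℤ) {Z : Matrix (Fin g) (Fin g) ℂ}

/-- **The sweep lands in `𝔥_g ∩ 𝔜_j`** (real inputs): for real symmetric `x`, `y` with `y ≻ 0`,
`Z(x, y) = (x + jxj) + i(y − jyj)` lies in `𝔥_g` and satisfies `jZ = −Z̄j` («Conversely, such a `z`, whose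
imaginary part is positive definite, belongs to `𝔜`»). [cite: Shimura1972FieldOfRationality, §3 Prop. 11 and its proof, pp. 175–176] -/
theorem sweep_mem_locus (hjj : j * j = -1) (hjT : jᵀ = -j) {x y : Matrix (Fin g) (Fin g) ℝ} (hxT : xᵀ = x)
    (hyT : yᵀ = y) (hy : y.PosDef)
    (hZ : Z = x.map Complex.ofReal + j.map (Int.cast : ℤ → ℂ) * x.map Complex.ofReal * j.map (Int.cast : ℤ → ℂ) +
      Complex.I • (y.map Complex.ofReal -
        j.map (Int.cast : ℤ → ℂ) * y.map Complex.ofReal * j.map (Int.cast : ℤ → ℂ))) :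
    Z ∈ siegelUpperHalfSpace g ∧ j.map (Int.cast : ℤ → ℂ) * Z = -Z.map conj * j.map (Int.cast : ℤ → ℂ) := by
  refine ⟨sweep_mem_siegelUpperHalfSpace j hjT hxT hyT hy hZ, sweep_rel j hjj ?_ ?_ hZ⟩
  · ext i k
    simp [Matrix.map_apply]
  · ext i k
    simp [Matrix.map_apply]

/-- **PROPOSITION 11, first assertion, for every `j`**: a symmetric complex `Z` lies in `𝔥_g ∩ 𝔜_j`
(`Im Z ≻ 0`, `jZ = −Z̄j`) iff `Z = (x + jxj) + i(y − jyj)` for some real symmetric `x`, `y` with `y ≻ 0`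
(«every point `z` of `𝔜` can be written in the form … Conversely, such a `z` … belongs to `𝔜`»; `⟹` is
g49-#1 `exists_sweep_eq_of_locus` with `x = Re Z/2`, `y = Im Z/2`). [cite: Shimura1972FieldOfRationality, §3 Prop. 11 and its proof, pp. 175–176] -/
theorem mem_locus_iff_exists_sweep (hjj : j * j = -1) (hjT : jᵀ = -j) :
    (Z ∈ siegelUpperHalfSpace g ∧ j.map (Int.cast : ℤ → ℂ) * Z = -Z.map conj * j.map (Int.cast : ℤ → ℂ)) ↔
      ∃ x y : Matrix (Fin g) (Fin g) ℝ, xᵀ = x ∧ yᵀ = y ∧ y.PosDef ∧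
        Z = x.map Complex.ofReal + j.map (Int.cast : ℤ → ℂ) * x.map Complex.ofReal * j.map (Int.cast : ℤ → ℂ) +
          Complex.I • (y.map Complex.ofReal -
            j.map (Int.cast : ℤ → ℂ) * y.map Complex.ofReal * j.map (Int.cast : ℤ → ℂ)) :=
  ⟨fun h ↦ exists_sweep_eq_of_locus j hjj h.1 h.2,
    fun ⟨_, _, hxT, hyT, hy, hZ⟩ ↦ sweep_mem_locus j hjj hjT hxT hyT hy hZ⟩

/-- **`𝔥_g ∩ 𝔜_j` is the image of the sweep**: as sets,
`𝔥_g ∩ {Z : jZ = −Z̄j} = Z({(x, y) : ᵗx = x, ᵗy = y, y ≻ 0})`. [cite: Shimura1972FieldOfRationality, §3 Prop. 11 and its proof, pp. 175–176] -/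
theorem locus_eq_image_sweep (hjj : j * j = -1) (hjT : jᵀ = -j) :
    siegelUpperHalfSpace g ∩
        {Z : Matrix (Fin g) (Fin g) ℂ | j.map (Int.cast : ℤ → ℂ) * Z = -Z.map conj * j.map (Int.cast : ℤ → ℂ)} =
      (fun p : Matrix (Fin g) (Fin g) ℝ × Matrix (Fin g) (Fin g) ℝ ↦
          p.1.map Complex.ofReal + j.map (Int.cast : ℤ → ℂ) * p.1.map Complex.ofReal * j.map (Int.cast : ℤ → ℂ) +
            Complex.I • (p.2.map Complex.ofReal -
              j.map (Int.cast : ℤ → ℂ) * p.2.map Complex.ofReal * j.map (Int.cast : ℤ → ℂ))) ''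
        {p | p.1ᵀ = p.1 ∧ p.2ᵀ = p.2 ∧ p.2.PosDef} := by
  ext Z
  rw [Set.mem_inter_iff, Set.mem_setOf_eq, mem_locus_iff_exists_sweep j hjj hjT, Set.mem_image]
  constructor
  · rintro ⟨x, y, hxT, hyT, hy, hZ⟩
    exact ⟨(x, y), ⟨hxT, hyT, hy⟩, hZ.symm⟩
  · rintro ⟨p, ⟨hxT, hyT, hy⟩, hZ⟩
    exact ⟨p.1, p.2, hxT, hyT, hy, hZ.symm⟩

/-- **«Therefore `𝔜` is non-empty»**, for every integral `j` with `j² = −1`, `ᵗj = −j`: the point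
`Z(0, ½·1) = i·1` lies in `𝔥_g ∩ 𝔜_j`. [cite: Shimura1972FieldOfRationality, §3 Prop. 11 («The set `𝔜` of Prop. 10 is non-empty»), pp. 175–176] -/
theorem locus_nonempty (hjj : j * j = -1) (hjT : jᵀ = -j) :
    (siegelUpperHalfSpace g ∩
      {Z : Matrix (Fin g) (Fin g) ℂ | j.map (Int.cast : ℤ → ℂ) * Z = -Z.map conj * j.map (Int.cast : ℤ → ℂ)}).Nonempty := by
  refine ⟨_, sweep_mem_locus j hjj hjT (x := 0) (y := (2⁻¹ : ℝ) • 1) Matrix.transpose_zero ?_ ?_ rfl⟩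
  · rw [Matrix.transpose_smul, Matrix.transpose_one]
  · exact Matrix.PosDef.one.smul (by norm_num)

/-- **A non-empty locus exists iff `g` is even** («Now we assume that `n` is even»): there is an integral
`j` with `j² = −1`, `ᵗj = −j` and `𝔥_g ∩ 𝔜_j ≠ ∅` iff `g` is even (g49-#1 `even_iff_exists_locusJ`).
[cite: Shimura1972FieldOfRationality, §3 (first paragraph) and Prop. 10–11, pp. 174–176] -/
theorem exists_locus_nonempty_iff_even :
    (∃ j : Matrix (Fin g) (Fin g) ℤ, j * j = -1 ∧ jᵀ = -j ∧
      (siegelUpperHalfSpace g ∩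
        {Z : Matrix (Fin g) (Fin g) ℂ |
          j.map (Int.cast : ℤ → ℂ) * Z = -Z.map conj * j.map (Int.cast : ℤ → ℂ)}).Nonempty) ↔ Even g := by
  constructor
  · rintro ⟨j, hjj, -, -⟩
    exact even_of_mul_self_eq_neg_one hjj
  · intro h
    obtain ⟨j, hjj, hjT⟩ := even_iff_exists_locusJ.1 h
    exact ⟨j, hjj, hjT, locus_nonempty j hjj hjT⟩

end SiegelModuli

end Literature.AlgebraicGeometry.ModuliOfAbelianVarieties
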